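import Summits.ResolutionOfSingularities.ResolutionOfSingularities.Theorems.EquisingularLiftEquisingularLiftNatTowerRoundThreeDefs
import Summits.ResolutionOfSingularities.ResolutionOfSingularities.Theorems.EquisingularLiftEquisingularLiftNatSubchainSupplierDriver
import HarnessLib

/-!
# [OURS · L1 W4.5(b) · EL♮(3)] HSUB′(ReachTower₄) FROM TWO INVARIANTS — the induction DRIVER for rung TOWER₄ (revision ₄ of res-L1-w45b-plan-1 RULING-8 (α)
# «all rounds along sections»: `TowerRound₃` / `ReachTower₄`, res-L1-w45b-lead-2 …NatTowerRoundThreeDefs p567373; stub `stub_elnat_coneTowerPointResolution`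
# @ `ReachTower₄` (TARGET-CONETOWER4 070981bcd9f54dfd), closer `stub_elnat_coneTowerPointResolution_of_subchainLift₄` p569465)

res-D-pv-018 g5 (TOWER₄ re-drive hand: res-L1-w45b-plan-1 DESK WORD 2026-08-27T21:17:49Z «018 TAKE TOWER₄ re-drive»). OURS; NOT a statement of any manuscript;
AI-written, weaker than expert review. No `sorry`; standard axioms. DEF-FREE. `--supports stmt-ResolutionOfSingularities-20148 --as helper`.
= res-D-pv-029's `hsub_reachTower₃_of_invariant` (…NatTowerDriverThree p563744) with EXACTLY TWO textual substitutions: the (round) hypothesis asks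
for closure of `INV₁` under `TowerRound₃` (not `TowerRound₂`), and the conclusion quantifies over `ReachTower₄` (not `ReachTower₃`); proof verbatim
(pure logic: the inner closure at `R := INV W`, the tower closure at `R₁ := INV₁ …`, then (final)). Consumed by the ₄ assembly `hsub_reachTower_four_of`
(…NatTowerAssemblyV6).
-/


set_option linter.dupNamespace false -- mandated namespace `Summit.<Summit>.<Problem>` of this single-conjunct summit
set_option linter.overlappingInstances false -- signatures carry `[IsDomain O] [IsDiscreteValuationRing O]`

noncomputable section

open CategoryTheory CategoryTheory.Limits AlgebraicGeometry TopologicalSpace Topology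
open Literature.AlgebraicGeometry.Resolution
open AlgebraicGeometry.Scheme.IdealSheafData

namespace Summit.ResolutionOfSingularities.ResolutionOfSingularities.Cruxes.EquisingularLiftNat.Sections

/-- **HSUB′(ReachTower₄) from an invariant of the inner chain and an invariant of the tower** (the induction driver; see the module
docstring). [folklore; pure logic over res-D-pv-029's K5′ binders and res-L1-w45b-lead-2's tower predicates] [OURS · L1 W4.5b] toward
`stub_elnat_coneTowerPointResolution`; NOT a statement of the manuscript. -/
theorem hsub_reachTower₄_of_invariant (k : Type) [Field k] (n : ℕ) :
    ∀ (O : Type) [CommRing O] [IsDomain O] [IsDiscreteValuationRing O] [IsAdicComplete (IsLocalRing.maximalIdeal O) O] [IsAlgClosed (IsLocalRing.ResidueField O)] (θ : O →+* k), Function.Surjective θ → ∀ (P : AlgebraicGeometry.Scheme.{0}) (q : P ⟶ AlgebraicGeometry.Spec (.of O)) (Y : Set P) (Ch : ∀ X' : AlgebraicGeometry.Scheme.{0}, (X' ⟶ P) → Set X' → Prop), (∀ (X' X'' : AlgebraicGeometry.Scheme.{0}) (σ' : X' ⟶ P) (S' : Set X') (C : X'.IdealSheafData) (τ : X'' ⟶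 X'), Ch X' σ' S' → Literature.AlgebraicGeometry.Resolution.IsBlowup τ C → Literature.AlgebraicGeometry.Resolution.Scheme.IsRegular C.subscheme → AlgebraicGeometry.Flat (C.subschemeι ≫ σ' ≫ q) → σ' '' (C.support : Set X') ⊆ {y | ¬ IsGenericPoint y Y} → (C.support : Set X') ∩ (σ' ≫ q) ⁻¹' {IsLocalRing.closedPoint O} ⊆ S' → Ch X'' (τ ≫ σ') (closure (τ ⁻¹' (S' \ (C.support : Set X'))))) → (∀ (X' : AlgebraicGeometry.Scheme.{0}) (σ' : X' ⟶ P) (S' : Set X'), Ch X' σ' S' → Summit.ResolutionOfSingularities.ResolutionOfSingularities.Theses.EquisingularLift.Split.Chain P Y X' σ' S') → Y ⊆ q ⁻¹' {IsLocalRing.closedPoint O} → IsIrreducible Y → IsClosed Y → AlgebraicGeometry.IsIntegral P → IsLocallyNoetherian P → Literature.AlgebraicGeometry.Resolution.Scheme.IsRegular P → AlgebraicGeometry.IsProper q → AlgebraicGeometry.SmoothOfRelativeDimension n q → ∀ (X' : AlgebraicGeometry.Scheme.{0}) (σ' : X' ⟶ P) (S' : Set X'), Ch X' σ' S' → AlgebraicGeometry.IsIntegral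 X' → IsLocallyNoetherian X' → Literature.AlgebraicGeometry.Resolution.Scheme.IsRegular X' → AlgebraicGeometry.IsDominant (σ' ≫ q) → ∀ (F₁ : AlgebraicGeometry.Scheme.{0}), AlgebraicGeometry.IsIntegral F₁ → ∀ (j : F₁ ⟶ X') (t : F₁ ⟶ AlgebraicGeometry.Spec (.of k)), IsPullback j t (σ' ≫ q) (AlgebraicGeometry.Spec.map (CommRingCat.ofHom θ)) → ∀ (T₁ : Set F₁), IsClosed T₁ → IsIrreducible T₁ → j '' T₁ = S' → ∀ (x : F₁) (hx : IsClosed ({x} : Set F₁)) (U : X'.Opens), AlgebraicGeometry.Smooth (U.ι ≫ σ' ≫ q) → ∀ (s : AlgebraicGeometry.Spec (.of O) ⟶ X'), s ≫ σ' ≫ q = 𝟙 _ → s (IsLocalRing.closedPoint O) ∈ U → s (IsLocalRing.closedPoint O) = j x → ringKrullDim (X'.presheaf.stalk (s (IsLocalRing.closedPoint O))) = ((n + 1 : ℕ) : WithBot ℕ∞) → IsRegularLocalRing (F₁.presheaf.stalk x) → (∀ c ∈ (s.ker.support : Set X'), ¬ IsGenericPoint (σ' c) Y) → ∀ (X₁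 : AlgebraicGeometry.Scheme.{0}) (τ₁ : X₁ ⟶ X'), Literature.AlgebraicGeometry.Resolution.IsBlowup τ₁ s.ker → AlgebraicGeometry.IsIntegral X₁ → IsLocallyNoetherian X₁ → Literature.AlgebraicGeometry.Resolution.Scheme.IsRegular X₁ → AlgebraicGeometry.IsDominant ((τ₁ ≫ σ') ≫ q) → ∀ (F₂ : AlgebraicGeometry.Scheme.{0}), AlgebraicGeometry.IsIntegral F₂ → ∀ (υ : F₂ ⟶ F₁), Literature.AlgebraicGeometry.Resolution.IsBlowup υ (AlgebraicGeometry.Scheme.IdealSheafData.vanishingIdeal (⟨{x}, hx⟩ : TopologicalSpace.Closeds F₁)) → ∀ (j₂ : F₂ ⟶ X₁) (t₂ : F₂ ⟶ AlgebraicGeometry.Spec (.of k)), IsPullback j₂ t₂ ((τ₁ ≫ σ') ≫ q) (AlgebraicGeometry.Spec.map (CommRingCat.ofHom θ)) → j₂ ≫ τ₁ = υ ≫ j → (s.ker.comap τ₁).comap j₂ = (AlgebraicGeometry.Scheme.IdealSheafData.vanishingIdeal (⟨{x}, hx⟩ : TopologicalSpace.Closeds F₁)).comap υ → IsIrreducible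 (closure (υ ⁻¹' (T₁ \ {x}))) → Ch X₁ (τ₁ ≫ σ') (j₂ '' closure (υ ⁻¹' (T₁ \ {x}))) → ∀ (INV : Set F₁ → ∀ G : AlgebraicGeometry.Scheme.{0}, (G ⟶ F₂) → Set G → Set G → Set G → Bool → Prop) (INV₁ : ∀ (F₉ : AlgebraicGeometry.Scheme.{0}) (Z₉ : Set F₉), IsClosed Z₉ → ∀ (F₁₀ : AlgebraicGeometry.Scheme.{0}), (F₁₀ ⟶ F₉) → ∀ G : AlgebraicGeometry.Scheme.{0}, (G ⟶ F₁₀) → Set G → Set G → Set G → Prop),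
      -- (base) the inner invariant after the point step, for every admissible `W` and every admitted seed shadow `K₂` (γ-cone)
      (∀ (W : Set F₁) (K₂ : Set F₂), (x ∈ W) → (¬ (υ ⁻¹' {x} ⊆ closure (υ ⁻¹' (W \ {x})))) → ((∃ U : F₁.affineOpens, x ∈ (U : F₁.Opens) ∧ ((AlgebraicGeometry.Scheme.IdealSheafData.vanishingIdeal (⟨closure W, isClosed_closure⟩ : TopologicalSpace.Closeds F₁)).ideal U).IsPrincipal)) → ((υ ⁻¹' {x} ∩ closure (υ ⁻¹' (W \ {x}))) ⊆ closure (υ ⁻¹' (T₁ \ {x}))) → (K₂ = ∅ ∨ (ConeForm F₁ x W ∧ K₂ = closure (υ ⁻¹' (W \ {x})))) → INV W F₂ (𝟙 F₂) (closure (υ ⁻¹' (T₁ \ {x}))) (υ ⁻¹' {x} ∩ closure (υ ⁻¹' (W \ {x}))) K₂ false) →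
      -- (step, flag kept) an in-carrier point blow-up at a REGULAR point of the running curve, shadow carried
      (∀ W : Set F₁, ∀ (G₁ G₂ : AlgebraicGeometry.Scheme.{0}) (β : G₁ ⟶ F₂) (T Z K : Set G₁) (b : Bool) (y : ↥((AlgebraicGeometry.Scheme.IdealSheafData.vanishingIdeal (⟨closure Z, isClosed_closure⟩ : TopologicalSpace.Closeds G₁))).subscheme) (υ₁ : G₂ ⟶ G₁) (hy : IsClosed ({(((AlgebraicGeometry.Scheme.IdealSheafData.vanishingIdeal (⟨closure Z, isClosed_closure⟩ : TopologicalSpace.Closeds G₁))).subschemeι y : G₁)} : Set G₁)), INV W G₁ β T Z K b → (((AlgebraicGeometry.Scheme.IdealSheafData.vanishingIdeal (⟨closure Z, isClosed_closure⟩ : TopologicalSpace.Closeds G₁))).subschemeι y : G₁) ∈ T → IsRegularLocalRing (((AlgebraicGeometry.Scheme.IdealSheafData.vanishingIdeal (⟨closure Z, isClosed_closure⟩ : TopologicalSpace.Closeds G₁))).subscheme.presheaf.stalk y) → IsRegularLocalRing (G₁.presheaf.stalk (((AlgebraicGeometry.Scheme.IdealSheafData.vanishingIdeal (⟨closure Z,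 isClosed_closure⟩ : TopologicalSpace.Closeds G₁))).subschemeι y : G₁)) → Literature.AlgebraicGeometry.Resolution.IsBlowup υ₁ (AlgebraicGeometry.Scheme.IdealSheafData.vanishingIdeal (⟨{(((AlgebraicGeometry.Scheme.IdealSheafData.vanishingIdeal (⟨closure Z, isClosed_closure⟩ : TopologicalSpace.Closeds G₁))).subschemeι y : G₁)}, hy⟩ : TopologicalSpace.Closeds G₁)) → INV W G₂ (υ₁ ≫ β) (closure (υ₁ ⁻¹' (T \ {(((AlgebraicGeometry.Scheme.IdealSheafData.vanishingIdeal (⟨closure Z, isClosed_closure⟩ : TopologicalSpace.Closeds G₁))).subschemeι y : G₁)}))) (closure (υ₁ ⁻¹' (Z \ {(((AlgebraicGeometry.Scheme.IdealSheafData.vanishingIdeal (⟨closure Z, isClosed_closure⟩ : TopologicalSpace.Closeds G₁))).subschemeι y : G₁)}))) (closure (υ₁ ⁻¹' (K \ {(((AlgebraicGeometry.Scheme.IdealSheafData.vanishingIdeal (⟨closure Z, isClosed_closure⟩ : TopologicalSpace.Closeds G₁))).subschemeι y : G₁)}))) b) →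
      -- (step, flag raised) an in-carrier point blow-up at the (at most one) NON-REGULAR point, shadow carried
      (∀ W : Set F₁, ∀ (G₁ G₂ : AlgebraicGeometry.Scheme.{0}) (β : G₁ ⟶ F₂) (T Z K : Set G₁) (y : ↥((AlgebraicGeometry.Scheme.IdealSheafData.vanishingIdeal (⟨closure Z, isClosed_closure⟩ : TopologicalSpace.Closeds G₁))).subscheme) (υ₁ : G₂ ⟶ G₁) (hy : IsClosed ({(((AlgebraicGeometry.Scheme.IdealSheafData.vanishingIdeal (⟨closure Z, isClosed_closure⟩ : TopologicalSpace.Closeds G₁))).subschemeι y : G₁)} : Set G₁)), INV W G₁ β T Z K false → (((AlgebraicGeometry.Scheme.IdealSheafData.vanishingIdeal (⟨closure Z, isClosed_closure⟩ : TopologicalSpace.Closeds G₁))).subschemeι y : G₁) ∈ T → ¬ IsRegularLocalRing (((AlgebraicGeometry.Scheme.IdealSheafData.vanishingIdeal (⟨closure Z, isClosed_closure⟩ : TopologicalSpace.Closeds G₁))).subscheme.presheaf.stalk y) → IsRegularLocalRing (G₁.presheaf.stalk (((AlgebraicGeometry.Scheme.IdealSheafData.vanishingIdeal (⟨closure Z,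 isClosed_closure⟩ : TopologicalSpace.Closeds G₁))).subschemeι y : G₁)) → Literature.AlgebraicGeometry.Resolution.IsBlowup υ₁ (AlgebraicGeometry.Scheme.IdealSheafData.vanishingIdeal (⟨{(((AlgebraicGeometry.Scheme.IdealSheafData.vanishingIdeal (⟨closure Z, isClosed_closure⟩ : TopologicalSpace.Closeds G₁))).subschemeι y : G₁)}, hy⟩ : TopologicalSpace.Closeds G₁)) → INV W G₂ (υ₁ ≫ β) (closure (υ₁ ⁻¹' (T \ {(((AlgebraicGeometry.Scheme.IdealSheafData.vanishingIdeal (⟨closure Z, isClosed_closure⟩ : TopologicalSpace.Closeds G₁))).subschemeι y : G₁)}))) (closure (υ₁ ⁻¹' (Z \ {(((AlgebraicGeometry.Scheme.IdealSheafData.vanishingIdeal (⟨closure Z, isClosed_closure⟩ : TopologicalSpace.Closeds G₁))).subschemeι y : G₁)}))) (closure (υ₁ ⁻¹' (K \ {(((AlgebraicGeometry.Scheme.IdealSheafData.vanishingIdeal (⟨closure Z, isClosed_closure⟩ : TopologicalSpace.Closeds G₁))).subschemeι y : G₁)}))) true) →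
      -- (curve) the carrier-curve blow-up: from the inner invariant to the tower invariant on the tower seed
      (∀ (W : Set F₁) (F₉ : AlgebraicGeometry.Scheme.{0}) (β₉ : F₉ ⟶ F₂) (T₉ Z₉ K₉ : Set F₉) (b₉ : Bool) (hZ₉ : IsClosed Z₉) (F₁₀ : AlgebraicGeometry.Scheme.{0}) (υ' : F₁₀ ⟶ F₉), INV W F₉ β₉ T₉ Z₉ K₉ b₉ → Z₉ ⊆ T₉ → ¬ (T₉ ⊆ Z₉) → Z₉.Infinite → Set.Finite {z : ↥((AlgebraicGeometry.Scheme.IdealSheafData.vanishingIdeal (⟨Z₉, hZ₉⟩ : TopologicalSpace.Closeds F₉))).subscheme | ¬ IsRegularLocalRing (((AlgebraicGeometry.Scheme.IdealSheafData.vanishingIdeal (⟨Z₉, hZ₉⟩ : TopologicalSpace.Closeds F₉))).subscheme.presheaf.stalk z)} → Literature.AlgebraicGeometry.Resolution.IsBlowup υ' (AlgebraicGeometry.Scheme.IdealSheafData.vanishingIdeal (⟨Z₉, hZ₉⟩ : TopologicalSpace.Closeds F₉)) → INV₁ F₉ Z₉ hZ₉ F₁₀ υ' F₁₀ (𝟙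 F₁₀) (closure (υ' ⁻¹' (T₉ \ Z₉))) (υ' ⁻¹' Z₉) (closure (υ' ⁻¹' (K₉ \ Z₉)))) →
      -- (pt-reg) the tower invariant is closed under `TowerPtReg₂`
      (∀ (F₉ : AlgebraicGeometry.Scheme.{0}) (Z₉ : Set F₉) (hZ₉ : IsClosed Z₉) (F₁₀ : AlgebraicGeometry.Scheme.{0}) (υ' : F₁₀ ⟶ F₉), TowerPtReg₂ F₉ F₁₀ υ' (INV₁ F₉ Z₉ hZ₉ F₁₀ υ')) →
      -- (pt-ram) … under `TowerPtRam₂`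
      (∀ (F₉ : AlgebraicGeometry.Scheme.{0}) (Z₉ : Set F₉) (hZ₉ : IsClosed Z₉) (F₁₀ : AlgebraicGeometry.Scheme.{0}) (υ' : F₁₀ ⟶ F₉), TowerPtRam₂ F₉ F₁₀ υ' (INV₁ F₉ Z₉ hZ₉ F₁₀ υ')) →
      -- (round) … under `TowerRound₃` (RULING-7: `DirStepSec` prepended in the Čech disjunct) (Čech-witnessed over a rational carrier, or cone-witnessed; shadow disjuncts inside)
      (∀ (F₉ : AlgebraicGeometry.Scheme.{0}) (Z₉ : Set F₉) (hZ₉ : IsClosed Z₉) (F₁₀ : AlgebraicGeometry.Scheme.{0}) (υ' : F₁₀ ⟶ F₉), TowerRound₃ F₉ F₁₀ υ' Z₉ hZ₉ (INV₁ F₉ Z₉ hZ₉ F₁₀ υ')) →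
      -- (final) the tower invariant yields the `Ch`-stage with a model square that K5′ asks for
      (∀ (F₉ : AlgebraicGeometry.Scheme.{0}) (Z₉ : Set F₉) (hZ₉ : IsClosed Z₉) (F₁₀ : AlgebraicGeometry.Scheme.{0}) (υ' : F₁₀ ⟶ F₉) (G : AlgebraicGeometry.Scheme.{0}) (γ : G ⟶ F₁₀) (T E K : Set G), INV₁ F₉ Z₉ hZ₉ F₁₀ υ' G γ T E K → ∃ (X₉ : AlgebraicGeometry.Scheme.{0}) (σ₉ : X₉ ⟶ P) (S₉ : Set X₉) (j₉ : G ⟶ X₉) (t₉ : G ⟶ AlgebraicGeometry.Spec (.of k)), Ch X₉ σ₉ S₉ ∧ AlgebraicGeometry.IsIntegral X₉ ∧ IsLocallyNoetherian X₉ ∧ Literature.AlgebraicGeometry.Resolution.Scheme.IsRegular X₉ ∧ AlgebraicGeometry.IsDominant (σ₉ ≫ q) ∧ IsPullback j₉ t₉ (σ₉ ≫ q) (AlgebraicGeometry.Spec.map (CommRingCat.ofHom θ)) ∧ j₉ '' T = S₉ ∧ IsClosed T ∧ IsIrreducible T ∧ AlgebraicGeometry.IsIntegral G) →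
      ∀ (F' : AlgebraicGeometry.Scheme.{0}) (β : F' ⟶ F₂) (T' : Set F'), ReachTower₄ F₁ F₂ υ x (closure (υ ⁻¹' (T₁ \ {x}))) F' β T' → ∃ (X₉ : AlgebraicGeometry.Scheme.{0}) (σ₉ : X₉ ⟶ P) (S₉ : Set X₉) (j₉ : F' ⟶ X₉) (t₉ : F' ⟶ AlgebraicGeometry.Spec (.of k)), Ch X₉ σ₉ S₉ ∧ AlgebraicGeometry.IsIntegral X₉ ∧ IsLocallyNoetherian X₉ ∧ Literature.AlgebraicGeometry.Resolution.Scheme.IsRegular X₉ ∧ AlgebraicGeometry.IsDominant (σ₉ ≫ q) ∧ IsPullback j₉ t₉ (σ₉ ≫ q) (AlgebraicGeometry.Spec.map (CommRingCat.ofHom θ)) ∧ j₉ '' T' = S₉ ∧ IsClosed T' ∧ IsIrreducible T' ∧ AlgebraicGeometry.IsIntegral F' := by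
  intro O _ _ _ _ _ θ hθ P q Y Ch hChStep hChSplit hYsp hYirr hYcl hPint hPnoeth hPreg hqprop hqsm X' σ' S' hCh' hX'int hX'noeth
    hX'reg hX'dom F₁ hF₁ j t hsq T₁ hT₁cl hT₁irr hjT₁ x hx U hU s hs hsU hsx hdim hxreg hsoff X₁ τ₁ hτ₁ hX₁int hX₁noeth hX₁reg
    hX₁dom F₂ hF₂ υ hυ j₂ t₂ hsq₂ hcomm hcarrier hirr₂ hCh₁ INV INV₁ hbase hstep hsing hcurve hptreg hptram hround hfinal F' β T' hReach
  obtain ⟨W, K₂, F₉, β₉, T₉, Z₉, K₉, b₉, hZ₉, F₁₀, υ', γ', E', K', hxW, hnot, hWpr, hZ₂T₂, hK₂, hinner, hZ₉T₉, hT₉Z₉, hZinf, hfin₉, hυ',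
    hcl, hβ⟩ := hReach
  -- the inner closure at `R := INV W`
  have h₉ : INV W F₉ β₉ T₉ Z₉ K₉ b₉ := hinner (INV W) (hbase W K₂ hxW hnot hWpr hZ₂T₂ hK₂) (hstep W) (hsing W)
  -- the tower closure at `R₁ := INV₁ …`
  have h' : INV₁ F₉ Z₉ hZ₉ F₁₀ υ' F' γ' T' E' K' :=
    hcl (INV₁ F₉ Z₉ hZ₉ F₁₀ υ') (hcurve W F₉ β₉ T₉ Z₉ K₉ b₉ hZ₉ F₁₀ υ' h₉ hZ₉T₉ hT₉Z₉ hZinf hfin₉ hυ')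
      (hptreg F₉ Z₉ hZ₉ F₁₀ υ') (hptram F₉ Z₉ hZ₉ F₁₀ υ') (hround F₉ Z₉ hZ₉ F₁₀ υ')
  exact hfinal F₉ Z₉ hZ₉ F₁₀ υ' F' γ' T' E' K' h'

end Summit.ResolutionOfSingularities.ResolutionOfSingularities.Cruxes.EquisingularLiftNat.Sections

end
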